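import Mathlib
import Literature.AlgebraicGeometry.Resolution.WeightedResolutionDatum
import Literature.AlgebraicGeometry.Resolution.CobordantBlowupGlobal
import Literature.AlgebraicGeometry.Resolution.ExtendedReesSaturation
import Summits.ResolutionOfSingularities.ResolutionOfSingularities.Theorems.WeightedInvariantDatumToEmbeddedStrictTransformCharts
import Summits.ResolutionOfSingularities.ResolutionOfSingularities.Theorems.WeightedInvariantDatumToEmbeddedRegular
import Summits.ResolutionOfSingularities.ResolutionOfSingularities.Theorems.WeightedInvariantWeightedThesisGlobalCobordantPlus
import HarnessLib

/-!
# The strict transform of an integral `X` on the global cobordant blow-up is integral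

Topic: `Summits/ResolutionOfSingularities/ResolutionOfSingularities/Theorems`. Stub
`stub_strictTransform` of the line `Sketch` of the crux `Theses.WeightedInvariant.DatumToEmbedded`
(statement `stmt-ResolutionOfSingularities-0572`) of the summit
`Summit.ResolutionOfSingularities.ResolutionOfSingularities`.

For a weighted resolution datum `D`, a closed immersion `i : X ⟶ Y` of an INTEGRAL scheme `X`
into a smooth separated quasi-compact `Y` over a perfect field of characteristic `p`, the guard
`∃ y, ¬ IsBot (inv y)` of axiom `(iii)`, and a Rees filtration `R'` on `Y` with the pieces of the
datum's centre (`R'.ideal = (D.centre f i.ker).piece`), one step of Włodarczyk's cobordant tower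
(arXiv:2203.03090, §2.3, §3.3) replaces `Y` by `B₊ = R'.plus ⊆ B = Spec_Y ⊕ₙ 𝒥ₙ tⁿ` and `X` by
the strict transform `X' = V(σˢ(ker i)|_{B₊})` (`R'.strictTransformPlus i.ker`, the
`t⁻¹`-saturation of the total transform). The stub: **`X'` is an integral scheme, and
`ker i ⊆ ker (X' ⟶ B₊ ⟶ Y)`** (so that `X' ⟶ X` exists by `IsClosedImmersion.lift`).

* `isIntegral_subscheme_of_charts` — a closed subscheme `V(I)` covered by affine opens `V j` with
  `I(V j)` prime, any two dominated by a third, is integral (reduced: `IsReduced.of_openCover`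
  over the `Spec (Γ(V j)/I(V j))` of Mathlib's `subschemeCover`; irreducible: any two non-empty
  opens meet, `PreirreducibleSpace.of_forall_nonempty_inter`);
* `isIntegral_subscheme_comap_ι`, `nonempty_subscheme_comap_ι` — `V(I|_O)` is an open
  subscheme of `V(I)` (`comapIso`, base change of the open immersion `O ↪ B`), integral when
  non-empty;
* `isIntegral_subscheme_iSup_colon`, `isIntegral_subscheme_iSup_colon_comap_ι` — for any `B`
  over `Y` and `𝔸¹` covered by charts `Spec ⊕ 𝒥ₙ(U) tⁿ` (the hypotheses `R'.ι_π`, `R'.ι_toA1`,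
  `R'.π_preimage`, `R'.image_plusChart_le_plus` of the tree's `B`), an ideal sheaf `K` with
  irreducible support and prime `K(U)` on the affine `U` meeting it, the strict transform is
  integral (charts file: prime chart ideals), and so is its restriction to any open containing
  the charts' complements of the vertex once a point of `supp K` lies off some `V(𝒥ₙ)`, `n > 0`
  (`exists_mem_support`) — Włodarczyk 3.3.12, the strict transform as the closure of
  `(X ∖ centre) × 𝔾ₘ`;
* `le_ker_subschemeι_comp_πPlus` — `K ⊆ ker (V(σˢ(K)|_{B₊}) → Y)` from `π^*K ⊆ σˢ(K)`;
* `isPrime_ker_ideal`, `isPreirreducible_support_ker` — for `K = ker i`, `X` integral;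
* `stub_strictTransform` — the assembly: `B` is locally Noetherian (the centre is a regular
  weighted centre under the guard, `GlobalCobordantPlus.locallyOfFiniteType_π`), and the generic
  point of `X` lies in `supp (ker i)` but not in the centre `supp (D.centre) = {inv max}`
  (`isBot_inv_apply_iff`: the function field is a regular local ring; `support_centre`,
  `not_isBot_of_isMaxOn`), i.e. off `V(𝒥ₙ)` for some `n > 0`.

All proofs are glue on Mathlib and the tree; no definitions, no named facts.
-/

noncomputable section

open scoped LaurentPolynomial
open LaurentPolynomial CategoryTheory CategoryTheory.Limits AlgebraicGeometry TopologicalSpace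
open Literature.AlgebraicGeometry.Resolution

set_option linter.dupNamespace false -- mandated namespace `…Theorems.DatumToEmbedded.<Topic>`

namespace Summit.ResolutionOfSingularities.ResolutionOfSingularities.Theorems.DatumToEmbedded.StrictTransform

universe u

/-! ## Integrality of a closed subscheme from a family of affine charts -/

section Integral

variable {X : Scheme.{u}} (I : X.IdealSheafData)

/-- **A closed subscheme covered by integral affine charts any two of which are dominated by a
third is integral.** If `V(I)` is covered by affine opens `V j` of `X` on which `I(V j)` is prime,
and for any two indices some `V j''` lies in both, then `V(I)` is an integral scheme: reduced
(locally), non-empty, and irreducible (any two non-empty opens meet, through the charts'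
generic points). [folklore] -/
theorem isIntegral_subscheme_of_charts {J : Type*} [Nonempty J] (V : J → X.affineOpens)
    (hprime : ∀ j, (I.ideal (V j)).IsPrime)
    (hcov : ∀ x : I.subscheme, ∃ j, I.subschemeι x ∈ (V j : X.Opens))
    (hdir : ∀ j j', ∃ j'', (V j'' : X.Opens) ≤ (V j : X.Opens) ⊓ (V j' : X.Opens)) :
    IsIntegral I.subscheme := by
  haveI hdom : ∀ j, IsDomain (Γ(X, V j) ⧸ I.ideal (V j)) := fun j => Ideal.Quotient.isDomain _
  have hrange : ∀ j, Set.range (I.subschemeCover.f (V j)) = I.subschemeι ⁻¹' (V j : Set X) :=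
    fun j => congrArg SetLike.coe (I.opensRange_subschemeCover_map (V j))
  let 𝒰 : I.subscheme.OpenCover := Scheme.Cover.mkOfCovers J
    (fun j => Spec (I.subschemeCover.X (V j))) (fun j => I.subschemeCover.f (V j)) fun x => by
      obtain ⟨j, hj⟩ := hcov x
      obtain ⟨y, hy⟩ : x ∈ Set.range (I.subschemeCover.f (V j)) := by rwa [hrange]
      exact ⟨j, y, hy⟩
  haveI hint : ∀ j, IsIntegral (𝒰.X j) := fun j =>
    (inferInstance : IsIntegral (Spec (CommRingCat.of (Γ(X, V j) ⧸ I.ideal (V j)))))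
  haveI : IsReduced I.subscheme := IsReduced.of_openCover _ 𝒰
  have hirr : ∀ j, IsPreirreducible (Set.range (𝒰.f j)) := fun j => by
    have h := (IrreducibleSpace.isIrreducible_univ (𝒰.X j)).image _
      (𝒰.f j).continuous.continuousOn
    rw [Set.image_univ] at h
    exact h.isPreirreducible
  have hne : ∀ j, (Set.range (𝒰.f j)).Nonempty := fun j => Set.range_nonempty _
  have hopen : ∀ j, IsOpen (Set.range (𝒰.f j)) := fun j =>
    (𝒰.f j).isOpenEmbedding.isOpen_range
  have hsub : ∀ j j'', (V j'' : X.Opens) ≤ V j →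
      Set.range (𝒰.f j'') ⊆ Set.range (𝒰.f j) := by
    intro j j'' h
    change Set.range (I.subschemeCover.f (V j'')) ⊆ Set.range (I.subschemeCover.f (V j))
    rw [hrange, hrange]
    exact Set.preimage_mono h
  haveI : PreirreducibleSpace I.subscheme := by
    refine PreirreducibleSpace.of_forall_nonempty_inter
      fun O₁ O₂ hO₁ hO₂ ⟨x₁, hx₁⟩ ⟨x₂, hx₂⟩ => ?_
    obtain ⟨j₁, y₁, rfl⟩ := 𝒰.exists_eq x₁
    obtain ⟨j₂, y₂, rfl⟩ := 𝒰.exists_eq x₂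
    obtain ⟨j, hj⟩ := hdir j₁ j₂
    have hW₁ := hsub j₁ j (hj.trans inf_le_left)
    have hW₂ := hsub j₂ j (hj.trans inf_le_right)
    obtain ⟨z, -, hzO, hzW⟩ := hirr j₁ O₁ (Set.range (𝒰.f j)) hO₁ (hopen j)
      ⟨_, ⟨y₁, rfl⟩, hx₁⟩ ((hne j).mono fun w hw => ⟨hW₁ hw, hw⟩)
    obtain ⟨w, -, hw₁, hw₂⟩ :=
      hirr j₂ O₁ O₂ hO₁ hO₂ ⟨z, hW₂ hzW, hzO⟩ ⟨_, ⟨y₂, rfl⟩, hx₂⟩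
    exact ⟨w, hw₁, hw₂⟩
  haveI : Nonempty I.subscheme :=
    ⟨𝒰.f (Classical.arbitrary J) (Classical.arbitrary _)⟩
  haveI : IrreducibleSpace I.subscheme := ⟨inferInstance⟩
  exact isIntegral_of_irreducibleSpace_of_isReduced _

/-- An open subscheme `V(I) ∩ O = V(I|_O)` of an integral closed subscheme is integral as soon as
it is non-empty. [folklore] -/
theorem isIntegral_subscheme_comap_ι (O : X.Opens) [IsIntegral I.subscheme]
    [Nonempty (I.comap O.ι).subscheme] : IsIntegral (I.comap O.ι).subscheme :=
  isIntegral_of_isOpenImmersion ((I.comapIso O.ι).hom ≫ pullback.snd O.ι I.subschemeι)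

/-- `V(I|_O)` is non-empty as soon as `O` meets the support of `I`. [folklore] -/
theorem nonempty_subscheme_comap_ι (O : X.Opens) {b : X} (hbO : b ∈ O) (hb : b ∈ I.support) :
    Nonempty (I.comap O.ι).subscheme := by
  have hb' : (⟨b, hbO⟩ : O) ∈ ((I.comap O.ι).support : Set O) := by
    rw [Scheme.IdealSheafData.support_comap]
    exact hb
  rw [← Scheme.IdealSheafData.range_subschemeι] at hb'
  obtain ⟨x, -⟩ := hb'
  exact ⟨x⟩

end Integral

/-! ## The strict transform of an irreducible `V(K)` with prime section ideals is integral -/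

section Assembly

variable {Y B : Scheme.{u}} [IsLocallyNoetherian B] (π : B ⟶ Y)
  (τ : B ⟶ Spec (CommRingCat.of (Polynomial ReesFiltration.ZZ.{u})))
  (R : ReesFiltration Y)
  (φ : ∀ U : Y.affineOpens, Spec (CommRingCat.of (R.sectionsRing U)) ⟶ B)
  [hφ : ∀ U, IsOpenImmersion (φ U)]
  (hφπ : ∀ U : Y.affineOpens, φ U ≫ π =
    Spec.map (CommRingCat.ofHom (algebraMap Γ(Y, U) (R.sectionsRing U))) ≫ U.2.fromSpec)
  (hφA : ∀ U : Y.affineOpens, φ U ≫ τ = Spec.map (CommRingCat.ofHom (R.polyToSections U)))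
  (hrange : ∀ U : Y.affineOpens, (φ U).opensRange = π ⁻¹ᵁ (U : Y.Opens))
  (K : Y.IdealSheafData)
  (hprime : ∀ y ∈ K.support, ∀ U : Y.affineOpens, y ∈ (U : Y.Opens) → (K.ideal U).IsPrime)
  (hirr : IsPreirreducible (K.support : Set Y))

include hφπ hφA hrange hprime hirr in
/-- **The strict transform `V(⋃ₙ (π^*K : τ^*(x)ⁿ))` on `B` is integral** when `B` is covered over
the affine opens `U` of `Y` by charts `Spec ⊕ 𝒥ₙ(U) tⁿ` compatible with `π` and `τ = t⁻¹`, the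
support of `K` is irreducible and non-empty, and `K(U)` is prime on every affine `U` meeting it
(for `K = ker i`, `X` integral): the charts over the `U` meeting `supp K` have prime ideals
(`isPrime_iSup_colon_ideal_chart`), cover the strict transform, and any two are dominated by
the chart over an affine neighbourhood of a common point of `supp K`. [cite: Wlodarczyk2022, 3.3.12] -/
theorem isIntegral_subscheme_iSup_colon {y₀ : Y} (hy₀ : y₀ ∈ K.support) :
    IsIntegral (⨆ n : ℕ, colon (K.comap π) ((affineBlowup.idealSheaf
        (Ideal.span {(Polynomial.X : Polynomial ReesFiltration.ZZ.{u})})).comap τ ^ n)).subscheme := by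
  -- the charts over the affine opens meeting `supp K`
  let J := {U : Y.affineOpens // ((K.support : Set Y) ∩ (U : Y.Opens)).Nonempty}
  have hJ : ∀ y ∈ K.support, ∀ W : Y.Opens, y ∈ W → ∃ U : J, y ∈ (U.1 : Y.Opens) ∧
      (U.1 : Y.Opens) ≤ W := by
    intro y hy W hyW
    obtain ⟨U, hU, hyU, hUW⟩ :=
      exists_isAffineOpen_mem_and_subset (X := Y) (x := y) (U := W) hyW
    exact ⟨⟨⟨U, hU⟩, y, hy, hyU⟩, hyU, hUW⟩
  obtain ⟨U₀, hU₀, -⟩ := hJ y₀ hy₀ ⊤ trivial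
  haveI : Nonempty J := ⟨U₀⟩
  haveI hprimeJ : ∀ U : J, (K.ideal U.1).IsPrime := fun U => by
    obtain ⟨y, hy, hyU⟩ := U.2
    exact hprime y hy U.1 hyU
  have hcoe : ∀ U : Y.affineOpens, ((φ U) ''ᵁ ⊤ : B.Opens) = π ⁻¹ᵁ (U : Y.Opens) :=
    fun U => by rw [Scheme.Hom.image_top_eq_opensRange, hrange]
  refine isIntegral_subscheme_of_charts _
    (fun U : J => ⟨(φ U.1) ''ᵁ ⊤, (isAffineOpen_top _).image_of_isOpenImmersion (φ U.1)⟩)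
    (fun U => isPrime_iSup_colon_ideal_chart π τ R U.1 (φ U.1) (hφπ U.1) (hφA U.1) K)
    (fun x => ?_) (fun U U' => ?_)
  · -- every point of the strict transform lies over `supp K`, in some chart
    have hx : (⨆ n : ℕ, colon (K.comap π) ((affineBlowup.idealSheaf
        (Ideal.span {(Polynomial.X : Polynomial ReesFiltration.ZZ.{u})})).comap τ ^ n)).subschemeι x ∈
        (K.comap π).support := by
      have hle : K.comap π ≤ ⨆ n : ℕ, colon (K.comap π) ((affineBlowup.idealSheaf
          (Ideal.span {(Polynomial.X : Polynomial ReesFiltration.ZZ.{u})})).comap τ ^ n) :=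
        le_trans (by rw [pow_zero, Scheme.IdealSheafData.one_eq_top, colon_top])
          (le_iSup (fun n : ℕ => colon (K.comap π) ((affineBlowup.idealSheaf
            (Ideal.span {(Polynomial.X : Polynomial ReesFiltration.ZZ.{u})})).comap τ ^ n)) 0)
      refine Scheme.IdealSheafData.support_antitone hle ?_
      have hx' := Set.mem_range_self (f := (⨆ n : ℕ, colon (K.comap π) ((affineBlowup.idealSheaf
          (Ideal.span {(Polynomial.X : Polynomial ReesFiltration.ZZ.{u})})).comap τ ^ n)).subschemeι) x
      rwa [Scheme.IdealSheafData.range_subschemeι] at hx'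
    rw [Scheme.IdealSheafData.support_comap] at hx
    obtain ⟨U, hU, -⟩ := hJ _ hx ⊤ trivial
    refine ⟨U, ?_⟩
    change _ ∈ (φ U.1) ''ᵁ ⊤
    rw [hcoe]
    exact hU
  · -- two charts meeting `supp K` are dominated by a third
    obtain ⟨y, hy, hyU⟩ := U.2
    obtain ⟨y', hy', hyU'⟩ := U'.2
    obtain ⟨z, hz, hzU, hzU'⟩ := hirr _ _ (U.1 : Y.Opens).2 (U'.1 : Y.Opens).2 ⟨y, hy, hyU⟩
      ⟨y', hy', hyU'⟩
    obtain ⟨W, hzW, hW⟩ := hJ z hz ((U.1 : Y.Opens) ⊓ U'.1) ⟨hzU, hzU'⟩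
    refine ⟨W, ?_⟩
    change (φ W.1) ''ᵁ ⊤ ≤ (φ U.1) ''ᵁ ⊤ ⊓ (φ U'.1) ''ᵁ ⊤
    rw [hcoe, hcoe, hcoe]
    exact fun b hb => ⟨hW.trans inf_le_left hb, hW.trans inf_le_right hb⟩

include hφπ hφA hrange hprime hirr in
/-- **The strict transform on `B₊` is integral.** With the data of
`isIntegral_subscheme_iSup_colon`, an open `O ⊆ B` containing the complements of the vertices of
all charts (for `B₊ = R.plus`: `image_plusChart_le_plus`), and a point `y₀ ∈ supp K` off the
support `V(𝒥ₙ)` of some positive piece of the Rees filtration (for the weighted centre of a datum: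
the generic point of `X`, which is not in the centre), the restriction `V(σˢ(K)|_O)` is a
non-empty open subscheme of the integral `V(σˢ(K))`, hence integral. [cite: Wlodarczyk2022, 3.3.12] -/
theorem isIntegral_subscheme_iSup_colon_comap_ι (O : B.Opens)
    (hO : ∀ U : Y.affineOpens, (φ U) ''ᵁ R.plusChart U ≤ O) {y₀ : Y}
    (hy₀ : y₀ ∈ K.support) (hy₀' : ∃ n : ℕ, 0 < n ∧ y₀ ∉ (R.ideal n).support) :
    IsIntegral ((⨆ n : ℕ, colon (K.comap π) ((affineBlowup.idealSheaf
        (Ideal.span {(Polynomial.X : Polynomial ReesFiltration.ZZ.{u})})).comap τ ^ n)).comap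
        O.ι).subscheme := by
  haveI := isIntegral_subscheme_iSup_colon π τ R φ hφπ hφA hrange K hprime hirr hy₀
  obtain ⟨U₀, hU₀, hy₀U₀, -⟩ :=
    exists_isAffineOpen_mem_and_subset (X := Y) (x := y₀) (U := ⊤) trivial
  haveI : (K.ideal ⟨U₀, hU₀⟩).IsPrime := hprime y₀ hy₀ ⟨U₀, hU₀⟩ hy₀U₀
  -- the saturation of `K(U₀)` does not contain the irrelevant ideal: `y₀ ∈ supp K ∖ V(𝒥ₙ)`
  have hirrel : ¬ (R.filtration ⟨U₀, hU₀⟩).irrelevant ≤ ⨆ n : ℕ,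
      ((K.ideal ⟨U₀, hU₀⟩).map (algebraMap Γ(Y, U₀) (R.sectionsRing ⟨U₀, hU₀⟩))).colon
        ((Ideal.span {(⟨T (-1), (R.filtration ⟨U₀, hU₀⟩).T_neg_one_mem_extendedRees⟩ :
          R.sectionsRing ⟨U₀, hU₀⟩)} ^ n : Ideal (R.sectionsRing ⟨U₀, hU₀⟩)) :
            Set (R.sectionsRing ⟨U₀, hU₀⟩)) := by
    intro h
    obtain ⟨n, hn, hy₀n⟩ := hy₀'
    have hle := ideal_le_of_irrelevant_le R ⟨U₀, hU₀⟩ K h hn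
    apply hy₀n
    rw [Scheme.IdealSheafData.mem_support_iff_of_mem (U := ⟨U₀, hU₀⟩) hy₀U₀,
      Scheme.mem_zeroLocus_iff]
    intro a ha
    have hK :=
      (Scheme.IdealSheafData.mem_support_iff_of_mem (U := ⟨U₀, hU₀⟩) hy₀U₀).mp hy₀
    rw [Scheme.mem_zeroLocus_iff] at hK
    exact hK a (hle ha)
  obtain ⟨b, hbO, hb⟩ :=
    exists_mem_support π τ R ⟨U₀, hU₀⟩ (φ ⟨U₀, hU₀⟩) (hφπ _) (hφA _) K O (hO _) hirrel
  haveI := nonempty_subscheme_comap_ι _ O hbO hb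
  exact isIntegral_subscheme_comap_ι _ O

end Assembly


/-! ## The stub: the strict transform of an integral `X` on the global cobordant blow-up -/

section Stub

/-- **The strict transform lies over `X`**: `K ⊆ ker (V(σˢ(K)|_{B₊}) ⟶ B₊ ⟶ Y)`, formally from
`π^*K ⊆ σˢ(K)` (the total transform lies in the strict transform). For `K = ker i` this is the
hypothesis of `IsClosedImmersion.lift` producing `X' ⟶ X`. [folklore] -/
theorem le_ker_subschemeι_comp_πPlus {Y : Scheme.{u}} (R : ReesFiltration Y)
    (K : Y.IdealSheafData) : K ≤ ((R.strictTransformPlus K).subschemeι ≫ R.πPlus).ker := by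
  rw [Scheme.Hom.ker_comp, Scheme.IdealSheafData.ker_subschemeι,
    Scheme.IdealSheafData.le_map_iff_comap_le]
  change K.comap (R.plus.ι ≫ R.π) ≤ (R.strictTransform K).comap R.plus.ι
  rw [Scheme.IdealSheafData.comap_comp]
  exact Scheme.IdealSheafData.comap_mono _ (R.comap_le_strictTransform K)

/-- For a closed immersion `i : X ⟶ Y` from an integral scheme, the ideal of `X` on an affine open
`U` containing a point of `X` is prime (the sections of `X` over the non-empty `i⁻¹U` form a
domain, onto which `Γ(Y, U)` surjects with kernel `(ker i)(U)`). [folklore] -/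
theorem isPrime_ker_ideal {X Y : Scheme.{u}} (i : X ⟶ Y) [IsClosedImmersion i] [IsIntegral X]
    {y : Y} (hy : y ∈ i.ker.support) (U : Y.affineOpens) (hyU : y ∈ (U : Y.Opens)) :
    (i.ker.ideal U).IsPrime := by
  have hy' : y ∈ Set.range i := by
    have h := i.support_ker
    rw [i.isClosedEmbedding.isClosed_range.closure_eq] at h
    rw [← h]
    exact hy
  obtain ⟨x, rfl⟩ := hy'
  haveI : Nonempty (i ⁻¹ᵁ (U : Y.Opens)) := ⟨⟨x, hyU⟩⟩
  rw [Scheme.Hom.ker_apply]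
  exact RingHom.ker_isPrime _

/-- The support of the kernel of a closed immersion from an irreducible scheme is irreducible
(it is the image). [folklore] -/
theorem isPreirreducible_support_ker {X Y : Scheme.{u}} (i : X ⟶ Y) [IsClosedImmersion i]
    [IrreducibleSpace X] : IsPreirreducible (i.ker.support : Set Y) := by
  rw [i.support_ker, isPreirreducible_iff_closure, ← Set.image_univ]
  exact (PreirreducibleSpace.isPreirreducible_univ (X := X)).image _ i.continuous.continuousOn

/-- **STUB `stub_strictTransform`** of the line `Sketch` of crux `DatumToEmbedded`: for a
weighted resolution datum `D`, a closed immersion `i : X ⟶ Y` of an INTEGRAL `X` into a smooth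
separated quasi-compact `Y` over a perfect field, the guard of axiom `(iii)`, and a Rees
filtration `R'` with the pieces of the datum's centre, the strict transform
`X' = V(σˢ(ker i)|_{B₊})` on the global cobordant blow-up `B₊ = R'.plus` is an integral scheme and
`ker i ⊆ ker (X' ⟶ B₊ ⟶ Y)` (so that `X' ⟶ X` exists). Integrality: `B` is covered by the charts
`Spec ⊕ 𝒥ₙ(U) tⁿ` (`R'.openCover`), on which `σˢ(ker i)` is the `t⁻¹`-saturation of the prime
`(ker i)(U)`, a prime (`isPrime_iSup_colon`); the charts over the affine `U` meeting `X` cover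
`V(σˢ)` and any two are dominated by a third (irreducibility of `X`), so `V(σˢ)` is integral, and
`X'` is a non-empty open subscheme of it — non-empty because the generic point of `X` is not in
the centre (`isBot_inv_apply_iff`: the function field is regular; `support_centre`,
`not_isBot_of_isMaxOn`), so over an affine neighbourhood of it the saturation misses the
irrelevant ideal. [cite: Wlodarczyk2022, 3.3.12] -/
theorem stub_strictTransform :
    ∀ {p : ℕ} (D : WeightedResolutionDatum p) {k : Type} [Field k] [CharP k p] [PerfectField k]
      {Y X : Scheme.{0}} (f : Y ⟶ Spec (.of k)) [Smooth f] [IsSeparated f] [QuasiCompact f]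
      (i : X ⟶ Y) [IsClosedImmersion i] [IsIntegral X],
      (∃ y : Y, ¬ IsBot (D.inv f i.ker y)) →
      ∀ (R' : ReesFiltration Y), R'.ideal = (D.centre f i.ker).piece →
      IsIntegral (R'.strictTransformPlus i.ker).subscheme ∧
      i.ker ≤ ((R'.strictTransformPlus i.ker).subschemeι ≫ R'.πPlus).ker := by
  intro p D k _ _ _ Y X f _ _ _ i _ _ hguard R' hR'
  refine ⟨?_, le_ker_subschemeι_comp_πPlus R' i.ker⟩
  -- `B` is locally Noetherian (the centre is a regular weighted centre under the guard)
  haveI : IsLocallyNoetherian Y := LocallyOfFiniteType.isLocallyNoetherian f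
  haveI : LocallyOfFiniteType R'.π := WeightedThesis.GlobalCobordantPlus.locallyOfFiniteType_π
    (D.centre f i.ker) R' hR' (D.isRegularWeightedCentre_centre f i.ker hguard)
  haveI : IsLocallyNoetherian R'.cobordantBlowup := LocallyOfFiniteType.isLocallyNoetherian R'.π
  -- the generic point of `X` lies in `X` and off the centre
  have hξ : i (genericPoint X) ∈ i.ker.support := i.range_subset_ker_support ⟨_, rfl⟩
  have hbot : IsBot (D.inv f i.ker (i (genericPoint X))) := by
    rw [isBot_inv_apply_iff D f i]
    change IsRegularLocalRing X.functionField
    infer_instance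
  have hξ' : ∃ n : ℕ, 0 < n ∧ i (genericPoint X) ∉ (R'.ideal n).support := by
    by_contra hcon
    push Not at hcon
    have hmem : i (genericPoint X) ∈ (D.centre f i.ker).support :=
      (ReesAlgebraData.mem_support_iff _).mpr fun n hn => hR' ▸ hcon n hn
    rw [D.support_centre f i.ker hguard] at hmem
    exact D.not_isBot_of_isMaxOn f i.ker hguard hmem hbot
  exact isIntegral_subscheme_iSup_colon_comap_ι R'.π R'.toA1 R'
    (fun U => R'.openCover.f ⟨U.1, U.2⟩) (hφ := fun U => R'.openCover.map_prop ⟨U.1, U.2⟩)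
    (fun U => R'.ι_π ⟨U.1, U.2⟩)
    (fun U => R'.ι_toA1 ⟨U.1, U.2⟩) (fun U => (R'.π_preimage ⟨U.1, U.2⟩).symm) i.ker
    (fun y hy U hyU => isPrime_ker_ideal i hy U hyU) (isPreirreducible_support_ker i) R'.plus
    (fun U => R'.image_plusChart_le_plus ⟨U.1, U.2⟩) hξ hξ'

end Stub

end Summit.ResolutionOfSingularities.ResolutionOfSingularities.Theorems.DatumToEmbedded.StrictTransform

end
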